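import Literature.Topology.FourManifolds.HomotopySpheresSumDimTwoLeaves
import Literature.Topology.FourManifolds.HomotopySpheresGroupDimOne
import HarnessLib

/-!
# Kervaire–Milnor's Theorem 1.1: the trust base after the Morse–Reeb route to `Θ₂ = 0`

Topic `Literature/Topology/FourManifolds`, fact seat of
`Literature.Topology.FourManifolds.exists_commGroup_homotopySphereClass` (M. Kervaire, J. Milnor,
*Groups of homotopy spheres I*, Ann. of Math. 77 (1963), Thm. 1.1, p. 504: "the h-cobordism
classes of homotopy `n`-spheres form an abelian group under the connected sum operation"; for
the tree's `Θₙ = HomotopySphereClass n`, oriented diffeomorphism classes, `n ≠ 0, 4`) and of its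
source-faithful variant `exists_commGroup_homotopySphereClass_of_ne_three` (`n ≠ 0, 3, 4`,
`HomotopySpheresGroupLeaves.lean`).  Everything here is **proved**; no named fact is introduced.

`HomotopySpheresGroupDimOne.lean` reduced the variant to four named facts
(`exists_commGroup_homotopySphereClass_of_ne_three_of_fourLeaves`: `Θ₂ = 0`, the
Whitehead–Hurewicz recognition of contractible manifolds, the homotopy half of Lemma 2.3, Smale's
h-cobordism theorem), the second of them serving only to make punctured homotopy spheres
contractible (`HomotopySphere.contractibleSpace_compl_image_ball`).  Since then the tree PROVED
the vanishing form of the Hurewicz theorem (`hurewicz_subsingleton_holds`) and the ENR route to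
that contractibility in dimensions `n ≥ 3` (`HomotopySpheresSumENR.lean`), so that
`HomotopySphere.contractibleSpace_compl_image_ball` follows from `Θ₂ = 0` alone
(`HomotopySphere.contractibleSpace_compl_image_ball_of_sphere_two`,
`HomotopySpheresSumDimTwoLeaves.lean`), and reduced `Θ₂ = 0` itself, through the smooth Reeb
theorem (`MorseTwoCriticalPoints.lean`), the absence of saddles on simply connected closed
surfaces (`HomotopyTwoSphereNoSaddle.lean`) and Milnor's rearrangement and cancellation
theorems (`SPC4HandlesSelfIndexingProofs.lean`), to Matsumoto's Thm. 3.35 in dimension `2`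
(`nonemptyDiffeomorphSphere_two_of_niceMorse`) and further to Assertion 6 in Milnor's proof of
the First Cancellation Theorem 5.4 (`nonemptyDiffeomorphSphere_two_of_modelChart`).

This file records the resulting trust base:

* `exists_commGroup_homotopySphereClass_of_ne_three_of_threeLeaves` — **Theorem 1.1 for
  `n ≠ 0, 3, 4` from THREE named facts**: (1) `Θ₂ = 0` (`nonemptyDiffeomorphSphere_two`;
  Kervaire–Milnor p. 507), (2) the homotopy theory in the proof of Lemma 2.3
  (`NullCobordism.isHomotopyEquiv_compl_ball_of_contractibleSpace`: excision, duality,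
  Whitehead), (3) Smale's h-cobordism theorem (`nonempty_diffeomorph_of_isHCobordant_of_five_le`,
  spc4.S15; Milnor 1965, Thm. 9.1);
* `exists_commGroup_homotopySphereClass_of_ne_three_of_niceMorse` /
  `…_of_ne_three_of_modelChart` — the same with (1) replaced by Matsumoto's Thm. 3.35 in
  dimension `2` (`exists_isMorse_ncard_criticalSetOfIndex_eq_one 2`), resp. by Assertion 6 of
  Milnor's proof of Thm. 5.4 (`Cobordism.Milnor1965_cancellation_modelChart`);
* `exists_commGroup_homotopySphereClass_of_threeLeaves_of_three` /
  `…_of_modelChart_of_three` — **the tree's fact** (`n ≠ 0, 4`) from the same three facts and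
  the Poincaré conjecture (spc4.S31 `nonempty_diffeomorph_sphere_three`: Perelman; Morgan–Tian
  2007, Cor. 0.2 (a)), which the instance `n = 3` of the tree's fact (inverses in the oriented
  diffeomorphism quotient of homotopy `3`-spheres) requires and which Kervaire–Milnor record as
  open (p. 507: "If the Poincaré hypothesis were proved, then Θ₃ = 0; but at present Θ₃ is
  unknown").

All of §2 of the paper — existence, Palais–Cerf uniqueness, unit, associativity and
commutativity of oriented connected sums (Lemma 2.1), compatibility with h-cobordism (Lemma 2.2),
the smooth halves of Lemmas 2.3 and 2.4 (ball removal, rotation construction), `Θ₁ = 0`, and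
the group axioms — is proved in the tree (`HomotopySpheresGroup*.lean`, `OrientedConnectedSum*.lean`,
`HomotopySpheresInverse*.lean`, `RotationBody*.lean`, `OneManifoldCircle.lean`).

## References

* M. Kervaire, J. Milnor, *Groups of homotopy spheres I*, Ann. of Math. (2) 77 (1963), 504–537:
  Thm. 1.1 (p. 504), §2 (pp. 505–507). doi:10.2307/1970128 [KervaireMilnorAnnals1963]
* J. Milnor, *Lectures on the h-cobordism theorem*, Princeton (1965), Thm. 5.4 (proof,
  Assertion 6), Thm. 9.1. [MilnorHCobordism1965]
* Y. Matsumoto, *An Introduction to Morse Theory*, AMS (2001), Thm. 3.35. [Matsumoto2001]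
* J. Morgan, G. Tian, *Ricci Flow and the Poincaré Conjecture*, Clay Math. Monogr. 3 (2007),
  Cor. 0.2 (a). [MorganTian2007]
-/

open scoped Manifold ContDiff Topology
open Set

noncomputable section

namespace Literature.Topology.FourManifolds

/-! ### Theorem 1.1 for `n ≠ 0, 3, 4` from three named facts -/

/-- **Kervaire–Milnor's Theorem 1.1 for `n ≠ 0, 3, 4`
(`exists_commGroup_homotopySphereClass_of_ne_three`) from THREE named facts**: (1) `Θ₂ = 0`
(`nonemptyDiffeomorphSphere_two`: every smooth surface homotopy equivalent to `S²` is
diffeomorphic to `S²`; Kervaire–Milnor p. 507), (2) the homotopy theory in the proof of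
Lemma 2.3 (`NullCobordism.isHomotopyEquiv_compl_ball_of_contractibleSpace`), (3) Smale's
h-cobordism theorem (`nonempty_diffeomorph_of_isHCobordant_of_five_le`, spc4.S15).  As
`exists_commGroup_homotopySphereClass_of_ne_three_of_fourLeaves`, with the contractibility of
punctured homotopy spheres now taken from `Θ₂ = 0` alone
(`HomotopySphere.contractibleSpace_compl_image_ball_of_sphere_two`: dimensions `0, 1` proved,
dimension `2` from `Θ₂ = 0`, dimensions `≥ 3` from the PROVED Hurewicz theorem by the ENR
route), so that the Whitehead–Hurewicz recognition principle and the CW type of manifolds are no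
longer inputs.  Dimensions `1, 2`: `Θₙ` is a point (`Θ₁ = 0` is the theorem
`HomotopySphere.nonempty_diffeomorph_sphere_one`); dimensions `≥ 5`: the class-level Lemmas
2.1–2.4 (`HomotopySphereClass.groupLawFacts_of_fourFacts`, the rotation construction of
Lemma 2.4 being the theorem `HomotopySphere.exists_nullCobordism_isOrientedConnectedSum_neg_holds`)
and the algebra of Theorem 1.1 (`HomotopySphereClass.GroupLawFacts.exists_commGroup`).
[cite: KervaireMilnorAnnals1963, Thm. 1.1, §2 pp. 504–507] [cite: MilnorHCobordism1965, Thm. 9.1] -/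
theorem exists_commGroup_homotopySphereClass_of_ne_three_of_threeLeaves
    (h2 : nonemptyDiffeomorphSphere_two.{0})
    (h23b : NullCobordism.isHomotopyEquiv_compl_ball_of_contractibleSpace)
    (hS15 : FourManifolds.nonempty_diffeomorph_of_isHCobordant_of_five_le.{0}) :
    exists_commGroup_homotopySphereClass_of_ne_three := by
  have hKball := HomotopySphere.contractibleSpace_compl_image_ball_of_sphere_two h2
  intro n h0 h3 h4
  obtain ⟨o₀⟩ := (isOrientable_sphere_holds n : Nonempty _)
  by_cases h2' : n ≤ 2
  · haveI := HomotopySphereClass.subsingleton_of_nonempty_diffeomorph_sphere h0 fun S =>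
      HomotopySphere.nonempty_diffeomorph_sphere_of_le_two h2 n S (Nat.one_le_iff_ne_zero.mpr h0) h2'
    exact HomotopySphereClass.exists_commGroup_of_subsingleton o₀
  · exact (HomotopySphereClass.groupLawFacts_of_fourFacts (by omega)
      (HomotopySphere.nonempty_homotopyEquiv_sphere_of_isConnectedSum_of hKball)
      (HomotopySphere.isHCobordant_sphere_of_isOrientedConnectedSum_neg_of_leaves hKball h23b
        HomotopySphere.exists_nullCobordism_isOrientedConnectedSum_neg_holds)
      hS15).exists_commGroup o₀

/-- **Theorem 1.1 for `n ≠ 0, 3, 4` from Matsumoto's Thm. 3.35 in dimension `2`, Lemma 2.3 and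
Smale**: as `exists_commGroup_homotopySphereClass_of_ne_three_of_threeLeaves`, with `Θ₂ = 0`
taken from the existence, on every closed connected surface, of a Morse function with one
critical point of index `0` and one of index `2`
(`exists_isMorse_ncard_criticalSetOfIndex_eq_one 2`; `nonemptyDiffeomorphSphere_two_of_niceMorse`:
no saddle on a simply connected closed surface, then the smooth Reeb theorem).
[cite: KervaireMilnorAnnals1963, Thm. 1.1, §2 pp. 504–507] [cite: Matsumoto2001, Thm. 3.35] [cite: MilnorHCobordism1965, Thm. 9.1] -/
theorem exists_commGroup_homotopySphereClass_of_ne_three_of_niceMorse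
    (hU : exists_isMorse_ncard_criticalSetOfIndex_eq_one.{0} 2)
    (h23b : NullCobordism.isHomotopyEquiv_compl_ball_of_contractibleSpace)
    (hS15 : FourManifolds.nonempty_diffeomorph_of_isHCobordant_of_five_le.{0}) :
    exists_commGroup_homotopySphereClass_of_ne_three :=
  exists_commGroup_homotopySphereClass_of_ne_three_of_threeLeaves
    (nonemptyDiffeomorphSphere_two_of_niceMorse hU) h23b hS15

/-- **Theorem 1.1 for `n ≠ 0, 3, 4` from Assertion 6 of Milnor's proof of the First
Cancellation Theorem 5.4, Lemma 2.3 and Smale**: as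
`exists_commGroup_homotopySphereClass_of_ne_three_of_threeLeaves`, with `Θ₂ = 0` taken from
`Cobordism.Milnor1965_cancellation_modelChart` through Milnor's rearrangement and cancellation
theorems (`nonemptyDiffeomorphSphere_two_of_modelChart`).
[cite: KervaireMilnorAnnals1963, Thm. 1.1, §2 pp. 504–507] [cite: MilnorHCobordism1965, proof of Thm. 5.4 (Assertion 6) and Thm. 9.1] -/
theorem exists_commGroup_homotopySphereClass_of_ne_three_of_modelChart
    (hE : Cobordism.Milnor1965_cancellation_modelChart.{0})
    (h23b : NullCobordism.isHomotopyEquiv_compl_ball_of_contractibleSpace)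
    (hS15 : FourManifolds.nonempty_diffeomorph_of_isHCobordant_of_five_le.{0}) :
    exists_commGroup_homotopySphereClass_of_ne_three :=
  exists_commGroup_homotopySphereClass_of_ne_three_of_threeLeaves
    (nonemptyDiffeomorphSphere_two_of_modelChart hE) h23b hS15

/-! ### The tree's fact (`n ≠ 0, 4`): the same leaves and the Poincaré conjecture -/

/-- **Kervaire–Milnor's Theorem 1.1 for `Θₙ = HomotopySphereClass n`, `n ≠ 0, 4` (the tree's
fact `exists_commGroup_homotopySphereClass`) from four named facts**: `Θ₂ = 0`
(`nonemptyDiffeomorphSphere_two`), the homotopy theory of Lemma 2.3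
(`NullCobordism.isHomotopyEquiv_compl_ball_of_contractibleSpace`), Smale's h-cobordism theorem
(`nonempty_diffeomorph_of_isHCobordant_of_five_le`), and — for the instance `n = 3` only, where
an inverse of `[Σ]` in the oriented diffeomorphism quotient forces `Σ # (-Σ) ≅ S³` — the
Poincaré conjecture (spc4.S31 `nonempty_diffeomorph_sphere_three`: Perelman; Morgan–Tian 2007,
Cor. 0.2 (a)), beyond the cited paper, which records `Θ₃` as unknown (p. 507).
[cite: KervaireMilnorAnnals1963, Thm. 1.1, §2 pp. 504–507] [cite: MilnorHCobordism1965, Thm. 9.1] [cite: MorganTian2007, Cor. 0.2 (a)] -/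
theorem exists_commGroup_homotopySphereClass_of_threeLeaves_of_three
    (h2 : nonemptyDiffeomorphSphere_two.{0})
    (h3 : FourManifolds.nonempty_diffeomorph_sphere_three.{0})
    (h23b : NullCobordism.isHomotopyEquiv_compl_ball_of_contractibleSpace)
    (hS15 : FourManifolds.nonempty_diffeomorph_of_isHCobordant_of_five_le.{0}) :
    exists_commGroup_homotopySphereClass :=
  exists_commGroup_homotopySphereClass_of_ne_three_of_three
    (exists_commGroup_homotopySphereClass_of_ne_three_of_threeLeaves h2 h23b hS15) h3

/-- **The tree's fact from Assertion 6 of Milnor's proof of Thm. 5.4, Lemma 2.3, Smale and the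
Poincaré conjecture** (`exists_commGroup_homotopySphereClass_of_threeLeaves_of_three` with
`Θ₂ = 0` from `nonemptyDiffeomorphSphere_two_of_modelChart`).
[cite: KervaireMilnorAnnals1963, Thm. 1.1, §2 pp. 504–507] [cite: MilnorHCobordism1965, proof of Thm. 5.4 (Assertion 6) and Thm. 9.1] [cite: MorganTian2007, Cor. 0.2 (a)] -/
theorem exists_commGroup_homotopySphereClass_of_modelChart_of_three
    (hE : Cobordism.Milnor1965_cancellation_modelChart.{0})
    (h3 : FourManifolds.nonempty_diffeomorph_sphere_three.{0})
    (h23b : NullCobordism.isHomotopyEquiv_compl_ball_of_contractibleSpace)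
    (hS15 : FourManifolds.nonempty_diffeomorph_of_isHCobordant_of_five_le.{0}) :
    exists_commGroup_homotopySphereClass :=
  exists_commGroup_homotopySphereClass_of_threeLeaves_of_three
    (nonemptyDiffeomorphSphere_two_of_modelChart hE) h3 h23b hS15

end Literature.Topology.FourManifolds

end
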